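import Summits.ABC.ABC.Theorems.EisensteinQuarantine.Negative.EisensteinQuarantineFalseOfForcedPairDegreeDepthLaw
import Summits.ABC.ABC.Theorems.DefiniteXiEisensteinQuarantineForcedPairOccurrence
import Summits.ABC.ABC.Theorems.DefiniteXiEisensteinQuarantineStubBrandtEigenLatticeRankOne
import HarnessLib

/-!
# `EisensteinQuarantine` (stmt-ABC-15023) is false under `FreyModularity` and the setup-free valuation law
# `ForcedPairXiDvd` — the adapter package of the research stub `stub_forcedPairOccurrence` (line `forced-pair-dlog`)

Support file (`--supports stmt-ABC-15023`) written by the stub-plan prover of `stub_forcedPairOccurrence`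
(STUB-PLAN-stub_forcedPairOccurrence.md, Step 1; ideator sheets k1/k2/k3 and the critic's `PlanRA`).  The registered
stub (= `ForcedPairOccurrence` of `EisensteinQuarantineFalseOfForcedPairOccurrence.lean`, verbatim) is a RESEARCH
statement: a 2-adic lower bound `v₂ ξ(E_(−ℓ,ℓ−1); N/ℓ, ℓ) ≥ v₂(q−1) − c` on the forced two-parameter family, for which
no printed theorem exists (`p = 2`, composite squarefree level, Eisenstein maximal ideal).  This file does not prove it.
It records, sorry-free and by name, what the stub IS and through which currencies it can be paid:

* `ForcedPairXiDvd` — the junk-free, setup-free core `∃ c, ∀ forced (q, ℓ), 2^{v₂(q−1)−c} ∣ brandtXi (N/ℓ) ℓ (a(E))`,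
  ONE natural number per pair; `forcedPairOccurrence_iff_xiDvd : ForcedPairOccurrence ↔ ForcedPairXiDvd` (setup
  independence `Brandt.XiSetup.brandtXi_eq_xi`, the landed dictionary `forcedPairOccurrence_of_dvd_xi` / `dvd_xi_of_occurrence`,
  and the junk values `brandtXi = 0` off a line / without a setup); the registered uncurried adapter
  `stub_forcedPairOccurrence_of_xiDvd` (bodies verbatim).
* the Brandt valuation currency: `ForcedPairDepthLaw → ForcedPairXiDvd` (`xiDvd_of_forcedPairDepthLaw`) and, now that the
  route item `BrandtEigenLatticeRankOne` is PROVED (`brandtEigenLatticeRankOne_holds`), the converse under `FreyModularity`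
  alone: `forcedPairDepthLaw_iff_xiDvd_of_freyModularity`.
* the optimal-degree currency (`forcedPairOccurrence_of_degreeDepthLaw`, through p135429); the ARS congruence-number
  currency and its old-lattice EXHIBIT form live in the sibling file
  `EisensteinQuarantineFalseOfForcedPairCongruenceDepthLaw.lean`.
* bootstraps on the free constant (`xiDvd_of_restricted`, `xiDvd_of_sideCondition`: every fixed-`j₀` / finite-census
  argument is worthless for the `∃ c` statement), the lead's insurance laws building `ProthDepthFamily` directly
  (`prothDepthFamily_of_supplyScopedLaw`, `prothDepthFamily_of_lossyLaw`), and the compositions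
  `prothDepthFamily_of_freyModularity_of_forcedPairXiDvd : FreyModularity → ForcedPairXiDvd → ProthDepthFamily` and
  `EisensteinQuarantine_false_of_ForcedPairXiDvd : FreyModularity → ForcedPairXiDvd → ¬ EisensteinQuarantine` (via p107816).

## References

* [Takahashi2001] S. Takahashi, J. Number Theory 90 (2001), Thm. 2.3 (p. 79).
* [Mazur1977] B. Mazur, Publ. Math. IHÉS 47 (1977), II.16.6, II.18.10.
-/

-- `Summit.<Summit>.<Problem>`: for the single-conjunct summit `ABC` the duplicate `ABC.ABC` is mandated.
set_option linter.dupNamespace false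

noncomputable section

open scoped BigOperators
open Literature.NumberTheory.Automorphic Literature.NumberTheory.EllipticCurves

namespace Summit.ABC.ABC.Theorems.EisensteinQuarantine.Negative

/-! ## The junk-free research core and its equivalence with the registered stub -/

/-- **Hypothesis `ForcedPairXiDvd` — the forced-pair 2-adic depth law, divisibility form (research statement, NOT
proved, NOT in print).**  There is `c` such that for all primes `q ≠ 2` and `ℓ` with `32 q ∣ ℓ − 1`, for the Frey curve
`E = E_(−ℓ, ℓ−1)` of the triple `1 + (ℓ−1) = ℓ` with conductor `N` (`= rad(ℓ(ℓ−1))`):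
`2^{v₂(q−1) − c} ∣ ξ(E; N/ℓ, ℓ) = brandtXi (N/ℓ) ℓ (a(E))`.  EQUIVALENT to the registered stub
`stub_forcedPairOccurrence` / `ForcedPairOccurrence` (`forcedPairOccurrence_iff_xiDvd`); strictly WEAKER in form than
`ForcedPairDepthLaw` (which forces `ξ ≠ 0`, `isLine_of_forcedPairDepthLaw`), equivalent to it under `FreyModularity`
(`forcedPairDepthLaw_iff_xiDvd_of_freyModularity`).  One natural number per pair `(q, ℓ)`; no setup, no `Fintype`, no
eigen-line quantifier.  HYPOTHESIS of the negative lemma `EisensteinQuarantine_false_of_ForcedPairXiDvd`; not a Literature fact. -/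
def ForcedPairXiDvd : Prop :=
  ∃ c : ℕ, ∀ q ℓ : ℕ, q.Prime → ℓ.Prime → q ≠ 2 → 32 * q ∣ ℓ - 1 →
    ∀ N : ℕ, (freyCurve (-(ℓ : ℤ)) ((ℓ - 1 : ℕ) : ℤ)).conductorNorm ℤ = N →
      2 ^ ((q - 1).factorization 2 - c) ∣
        brandtXi (N / ℓ) ℓ (fun n => (freyCurve (-(ℓ : ℤ)) ((ℓ - 1 : ℕ) : ℤ)).LFunction n)

/-- **`ForcedPairXiDvd → ForcedPairOccurrence`** (the registered stub, by its Theorems-side name), with `c ↦ c + 2`: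
setup independence `Brandt.XiSetup.brandtXi_eq_xi` turns the `brandtXi` divisibility into `2^{v₂(q−1)−c} ∣ S.xi` in every
setup, and the landed `forcedPairOccurrence_of_dvd_xi` (p132787: dictionary p96490 + `d ∣ 12`) produces the `w`-orthogonal
witness `ψ`. [folklore] -/
theorem forcedPairOccurrence_of_xiDvd (h : ForcedPairXiDvd) : ForcedPairOccurrence := by
  obtain ⟨c, hc⟩ := h
  refine Summit.ABC.ABC.Theorems.forcedPairOccurrence_of_dvd_xi
    ⟨c, fun q ℓ hq hℓ hq2 h32 N hN S _ φ _ _ => ?_⟩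
  rw [← S.brandtXi_eq_xi]
  exact hc q ℓ hq hℓ hq2 h32 N hN

/-- **`ForcedPairOccurrence → ForcedPairXiDvd`** (same `c`), so `ForcedPairXiDvd` is an honest restatement and not a
strengthening: in a setup on a line the occurrence forces `2^k ∣ S.xi = brandtXi` (`dvd_xi_of_occurrence`, p97646); off a
line `brandtXi = 0` (`brandtXi_eq_zero_of_not_isLine`) and without a setup `brandtXi = 0` (`brandtXi_of_isEmpty`) — the
junk value is divisible by everything. [folklore] -/
theorem xiDvd_of_forcedPairOccurrence (h : ForcedPairOccurrence) : ForcedPairXiDvd := by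
  obtain ⟨c, hc⟩ := h
  refine ⟨c, fun q ℓ hq hℓ hq2 h32 N hN => ?_⟩
  by_cases hne : Nonempty (Brandt.XiSetup (N / ℓ) ℓ)
  · obtain ⟨S⟩ := hne
    letI : Fintype (Brandt.ClassSet S.O) := Fintype.ofFinite _
    by_cases hline : ∃ φ : Brandt.ClassSet S.O → ℤ, φ ≠ 0 ∧
        Brandt.eigenLattice (N / ℓ * ℓ) (Brandt.matrix S.O)
          (fun n => (freyCurve (-(ℓ : ℤ)) ((ℓ - 1 : ℕ) : ℤ)).LFunction n) = ℤ ∙ φ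
    · obtain ⟨φ, hφ, hL⟩ := hline
      obtain ⟨ψ, hψ, hcong⟩ := hc q ℓ hq hℓ hq2 h32 N hN S φ hφ hL
      rw [S.brandtXi_eq_xi]
      exact (Summit.ABC.ABC.Theorems.dvd_xi_of_occurrence S _ hφ hL _ hψ hcong).1
    · rw [brandtXi_eq_zero_of_not_isLine S _ hline]; exact dvd_zero _
  · rw [brandtXi_of_isEmpty (not_nonempty_iff.mp hne)]; exact dvd_zero _

/-- **The registered stub is equivalent to the setup-free divisibility law**:
`ForcedPairOccurrence ↔ ForcedPairXiDvd` (`→` with the same `c`, `←` with `c + 2`). [folklore] -/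
theorem forcedPairOccurrence_iff_xiDvd : ForcedPairOccurrence ↔ ForcedPairXiDvd :=
  ⟨xiDvd_of_forcedPairOccurrence, forcedPairOccurrence_of_xiDvd⟩

/-- **Uncurried adapter, registered as a sub-goal of stmt-ABC-15023** (`stub_forcedPairOccurrence_of_xiDvd`; bodies
verbatim: the hypothesis is `ForcedPairXiDvd`, the conclusion is the registered stub `stub_forcedPairOccurrence`):
the setup-free divisibility law implies the stub.  Working corollary: `forcedPairOccurrence_of_xiDvd`. [folklore] -/
theorem stub_forcedPairOccurrence_of_xiDvd :
    (∃ c : ℕ, ∀ q ℓ : ℕ, q.Prime → ℓ.Prime → q ≠ 2 → 32 * q ∣ ℓ - 1 →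
      ∀ N : ℕ, (freyCurve (-(ℓ : ℤ)) ((ℓ - 1 : ℕ) : ℤ)).conductorNorm ℤ = N →
        2 ^ ((q - 1).factorization 2 - c) ∣
          brandtXi (N / ℓ) ℓ (fun n => (freyCurve (-(ℓ : ℤ)) ((ℓ - 1 : ℕ) : ℤ)).LFunction n)) →
    ∃ c : ℕ, ∀ q ℓ : ℕ, q.Prime → ℓ.Prime → q ≠ 2 → 32 * q ∣ ℓ - 1 →
      ∀ N : ℕ, (freyCurve (-(ℓ : ℤ)) ((ℓ - 1 : ℕ) : ℤ)).conductorNorm ℤ = N →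
      ∀ (S : Brandt.XiSetup (N / ℓ) ℓ) [Fintype (Brandt.ClassSet S.O)],
        ∀ φ : Brandt.ClassSet S.O → ℤ, φ ≠ 0 →
          Brandt.eigenLattice (N / ℓ * ℓ) (Brandt.matrix S.O)
              (fun n => (freyCurve (-(ℓ : ℤ)) ((ℓ - 1 : ℕ) : ℤ)).LFunction n) = ℤ ∙ φ →
          ∃ ψ : Brandt.ClassSet S.O → ℤ,
            ∑ i, (Brandt.weight S.O i : ℤ) * ψ i * φ i = 0 ∧
              ∀ i, ((2 ^ ((q - 1).factorization 2 - c) : ℕ) : ℤ) ∣ φ i - ψ i :=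
  fun h => forcedPairOccurrence_of_xiDvd h

/-! ## Currency 1 — the Brandt valuation law `ForcedPairDepthLaw` -/

/-- **Arithmetic**: `2^j ≤ 2^c · ordProj[2] x → 2^{j−c} ∣ x` (trivial for `x = 0`). [folklore] -/
theorem two_pow_sub_dvd_of_le_ordProj {j c x : ℕ} (h : 2 ^ j ≤ 2 ^ c * ordProj[2] x) :
    2 ^ (j - c) ∣ x := by
  rcases eq_or_ne x 0 with rfl | hx
  · exact dvd_zero _
  · have hf : 2 ^ j ≤ 2 ^ (c + x.factorization 2) := by rwa [pow_add]
    have hjc : j ≤ c + x.factorization 2 := (Nat.pow_le_pow_iff_right (by norm_num)).mp hf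
    exact (Nat.pow_dvd_pow 2 (by omega)).trans (Nat.ordProj_dvd x 2)

/-- **`ForcedPairDepthLaw → ForcedPairXiDvd`** (same `c`): the valuation form is the divisibility form plus `ξ ≠ 0`.
[folklore] -/
theorem xiDvd_of_forcedPairDepthLaw (h : ForcedPairDepthLaw) : ForcedPairXiDvd := by
  obtain ⟨c, hc⟩ := h
  exact ⟨c, fun q ℓ hq hℓ hq2 h32 N hN => two_pow_sub_dvd_of_le_ordProj (hc q ℓ hq hℓ hq2 h32 N hN)⟩

/-- **`ForcedPairDepthLaw → ForcedPairOccurrence`** (the registered stub; `c ↦ c + 2`).  The tree had only the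
converse direction (`forcedPairDepthLaw_of_forcedPairOccurrence`, p134266, under rank one + modularity). [folklore] -/
theorem forcedPairOccurrence_of_forcedPairDepthLaw (h : ForcedPairDepthLaw) : ForcedPairOccurrence :=
  forcedPairOccurrence_of_xiDvd (xiDvd_of_forcedPairDepthLaw h)

/-- **`FreyModularity → ForcedPairOccurrence → ForcedPairDepthLaw`** — p134266's
`forcedPairDepthLaw_of_forcedPairOccurrence` with its multiplicity-one hypothesis DISCHARGED by the landed
`brandtEigenLatticeRankOne_holds` (route item stmt-ABC-17203, = `takahashi2001_brandtEigenLattice_rank_one` by `Iff.rfl`).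
[cite: Takahashi2001, §2 p. 78] -/
theorem forcedPairDepthLaw_of_freyModularity_of_forcedPairOccurrence
    (hM : Summit.ABC.ABC.Theses.DefiniteXi.FreyModularity) (hO : ForcedPairOccurrence) : ForcedPairDepthLaw :=
  forcedPairDepthLaw_of_occurrence
    (Summit.ABC.ABC.Theorems.freyEigenLinePrime_of_brandtEigenLatticeRankOne_of_freyModularity
      Summit.ABC.ABC.Theorems.brandtEigenLatticeRankOne_holds hM) hO

/-- **Under `FreyModularity` the valuation law and the divisibility law coincide**:
`ForcedPairDepthLaw ↔ ForcedPairXiDvd` (`→` unconditionally; `←` through the stub and the proved eigen-line).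
[cite: Takahashi2001, §2 p. 78] -/
theorem forcedPairDepthLaw_iff_xiDvd_of_freyModularity (hM : Summit.ABC.ABC.Theses.DefiniteXi.FreyModularity) :
    ForcedPairDepthLaw ↔ ForcedPairXiDvd :=
  ⟨xiDvd_of_forcedPairDepthLaw, fun h =>
    forcedPairDepthLaw_of_freyModularity_of_forcedPairOccurrence hM (forcedPairOccurrence_of_xiDvd h)⟩

/-! ## Currency 2 — optimal modular degrees (Takahashi transfer, p135429) -/

/-- **Degree currency**: Takahashi Thm 2.3 + `FreyModularity` + `ForcedPairDegreeDepthLaw ⟹` the registered stub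
(through `forcedPairDepthLaw_of_degreeDepthLaw`, p135429).  `hMod` is the skeleton's own `stub_freyModularity`
(item stmt-ABC-11340); `hT` is a named fact TRUE in print. [cite: Takahashi2001, Thm. 2.3 (p. 79)] -/
theorem forcedPairOccurrence_of_degreeDepthLaw (hT : takahashi2001_thm_2_3)
    (hMod : Summit.ABC.ABC.Theses.DefiniteXi.FreyModularity) (hD : ForcedPairDegreeDepthLaw) :
    ForcedPairOccurrence :=
  forcedPairOccurrence_of_forcedPairDepthLaw (forcedPairDepthLaw_of_degreeDepthLaw hT hMod hD)

/-! ## Bootstraps on the free constant `c` -/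

/-- **Bootstrap on the partner**: it suffices to treat partners `q ≡ 1 (mod 2^{j₀})` for any FIXED `j₀` (cost
`c ↦ c + j₀`; below `j₀` the modulus `2^{j−c−j₀}` is `1`).  Corollary: every small-`j` or finite-census argument is
worthless for the `∃ c` statement — only `j → ∞` along the supply matters. [folklore] -/
theorem xiDvd_of_restricted (j₀ : ℕ)
    (h : ∃ c : ℕ, ∀ q ℓ : ℕ, q.Prime → ℓ.Prime → q ≠ 2 → 2 ^ j₀ ∣ q - 1 → 32 * q ∣ ℓ - 1 →
      ∀ N : ℕ, (freyCurve (-(ℓ : ℤ)) ((ℓ - 1 : ℕ) : ℤ)).conductorNorm ℤ = N →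
        2 ^ ((q - 1).factorization 2 - c) ∣
          brandtXi (N / ℓ) ℓ (fun n => (freyCurve (-(ℓ : ℤ)) ((ℓ - 1 : ℕ) : ℤ)).LFunction n)) :
    ForcedPairXiDvd := by
  obtain ⟨c, hc⟩ := h
  refine ⟨c + j₀, fun q ℓ hq hℓ hq2 h32 N hN => ?_⟩
  by_cases hj : 2 ^ j₀ ∣ q - 1
  · exact (Nat.pow_dvd_pow 2 (by omega)).trans (hc q ℓ hq hℓ hq2 hj h32 N hN)
  · have hqm1 : q - 1 ≠ 0 := by have := hq.two_le; omega
    have hlt : (q - 1).factorization 2 < j₀ :=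
      lt_of_not_ge fun hle => hj ((Nat.prime_two.pow_dvd_iff_le_factorization hqm1).mpr hle)
    have h0 : (q - 1).factorization 2 - (c + j₀) = 0 := by omega
    rw [h0, pow_zero]
    exact one_dvd _

/-- **Bootstrap on the cofactor**: the side condition `32 q < ℓ` is automatic (`32 q ∣ ℓ − 1`, `ℓ − 1 > 0`), so it may
be assumed for free. [folklore] -/
theorem xiDvd_of_sideCondition
    (h : ∃ c : ℕ, ∀ q ℓ : ℕ, q.Prime → ℓ.Prime → q ≠ 2 → 32 * q ∣ ℓ - 1 → 32 * q < ℓ →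
      ∀ N : ℕ, (freyCurve (-(ℓ : ℤ)) ((ℓ - 1 : ℕ) : ℤ)).conductorNorm ℤ = N →
        2 ^ ((q - 1).factorization 2 - c) ∣
          brandtXi (N / ℓ) ℓ (fun n => (freyCurve (-(ℓ : ℤ)) ((ℓ - 1 : ℕ) : ℤ)).LFunction n)) :
    ForcedPairXiDvd := by
  obtain ⟨c, hc⟩ := h
  refine ⟨c, fun q ℓ hq hℓ hq2 h32 N hN => hc q ℓ hq hℓ hq2 h32 ?_ N hN⟩
  have hℓ1 : 0 < ℓ - 1 := by have := hℓ.two_le; omega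
  have := Nat.le_of_dvd hℓ1 h32
  omega

/-! ## Insurance for the lead: weaker laws that still build `ProthDepthFamily` -/

/-- **Supply-scoped law ⟹ `ProthDepthFamily`**: a law quantified by the supply exponent `s` (hypotheses `2^s ∣ q − 1`,
`2^s q ∣ ℓ − 1`, conclusion `2^s ≤ 2^c · ordProj[2] ξ`, not `2^{v₂(q−1)}`) already builds the hypothesis of p107816 from
the two-prime supply.  Use if the depth turns out to be driven by `s` rather than by `v₂(q−1)`. [folklore] -/
theorem prothDepthFamily_of_supplyScopedLaw
    (hSup : ∃ A s₁ : ℕ, ∀ s : ℕ, s₁ ≤ s →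
      ∃ q ℓ : ℕ, q.Prime ∧ ℓ.Prime ∧ 2 ^ s ∣ q - 1 ∧ 2 ^ s * q ∣ ℓ - 1 ∧ ℓ ≤ 2 ^ (A * s))
    (hF : ∃ c : ℕ, ∀ s q ℓ : ℕ, q.Prime → ℓ.Prime → 5 ≤ s → 2 ^ s ∣ q - 1 → 2 ^ s * q ∣ ℓ - 1 →
      ∀ N : ℕ, (freyCurve (-(ℓ : ℤ)) ((ℓ - 1 : ℕ) : ℤ)).conductorNorm ℤ = N →
        2 ^ s ≤ 2 ^ c * ordProj[2] (brandtXi (N / ℓ) ℓ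
          (fun n => (freyCurve (-(ℓ : ℤ)) ((ℓ - 1 : ℕ) : ℤ)).LFunction n))) :
    ProthDepthFamily := by
  obtain ⟨A, s₁, hAs⟩ := hSup
  obtain ⟨c, hc⟩ := hF
  refine ⟨c, A, fun s₀ => ?_⟩
  obtain ⟨q, ℓ, hq, hℓ, hsq, hsl, hℓA⟩ := hAs (max s₀ (max s₁ 5)) ((le_max_left _ _).trans (le_max_right _ _))
  exact ⟨max s₀ (max s₁ 5), ℓ, le_max_left _ _, hℓ, (Dvd.intro q rfl).trans hsl, hℓA, fun N hN =>
    hc _ q ℓ hq hℓ ((le_max_right _ _).trans (le_max_right _ _)) hsq hsl N hN⟩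

/-- **Lossy law ⟹ `ProthDepthFamily`**: a fixed linear loss `j ↦ j / k` in the exponent still builds the hypothesis of
p107816, with `A ↦ A·k` (exponential-in-`s` depth against the polynomial allowance is all the kill uses). [folklore] -/
theorem prothDepthFamily_of_lossyLaw
    (hSup : ∃ A s₁ : ℕ, ∀ s : ℕ, s₁ ≤ s →
      ∃ q ℓ : ℕ, q.Prime ∧ ℓ.Prime ∧ 2 ^ s ∣ q - 1 ∧ 2 ^ s * q ∣ ℓ - 1 ∧ ℓ ≤ 2 ^ (A * s))
    (hF : ∃ c k : ℕ, 0 < k ∧ ∀ q ℓ : ℕ, q.Prime → ℓ.Prime → q ≠ 2 → 32 * q ∣ ℓ - 1 →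
      ∀ N : ℕ, (freyCurve (-(ℓ : ℤ)) ((ℓ - 1 : ℕ) : ℤ)).conductorNorm ℤ = N →
        2 ^ ((q - 1).factorization 2 / k) ≤ 2 ^ c * ordProj[2] (brandtXi (N / ℓ) ℓ
          (fun n => (freyCurve (-(ℓ : ℤ)) ((ℓ - 1 : ℕ) : ℤ)).LFunction n))) :
    ProthDepthFamily := by
  obtain ⟨A, s₁, hAs⟩ := hSup
  obtain ⟨c, k, hk, hc⟩ := hF
  refine ⟨c, A * k, fun s₀ => ?_⟩
  -- run the supply at exponent `k · t`, `t := max s₀ s₁ 5`; the witness of the family is `(t, ℓ)`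
  set t : ℕ := max s₀ (max s₁ 5) with ht
  have ht5 : 5 ≤ t := (le_max_right _ _).trans (le_max_right _ _)
  have hts₁ : s₁ ≤ t := (le_max_left _ _).trans (le_max_right _ _)
  have hkt : t ≤ k * t := Nat.le_mul_of_pos_left t hk
  obtain ⟨q, ℓ, hq, hℓ, hsq, hsl, hℓA⟩ := hAs (k * t) (hts₁.trans hkt)
  have h32s : (32 : ℕ) ∣ 2 ^ (k * t) := by
    rw [show (32 : ℕ) = 2 ^ 5 by norm_num]; exact Nat.pow_dvd_pow 2 (ht5.trans hkt)
  have hq2 : q ≠ 2 := by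
    intro h
    rw [h] at hsq
    have := Nat.le_of_dvd (by norm_num) (h32s.trans hsq)
    omega
  have h32q : 32 * q ∣ ℓ - 1 := (Nat.mul_dvd_mul_right h32s q).trans hsl
  have h2tl : 2 ^ t ∣ ℓ - 1 := (Nat.pow_dvd_pow 2 hkt).trans ((Dvd.intro q rfl).trans hsl)
  refine ⟨t, ℓ, le_max_left _ _, hℓ, h2tl, ?_, fun N hN => ?_⟩
  · calc ℓ ≤ 2 ^ (A * (k * t)) := hℓA
      _ = 2 ^ (A * k * t) := by rw [mul_assoc]
  · have h := hc q ℓ hq hℓ hq2 h32q N hN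
    have hqm1 : q - 1 ≠ 0 := by have := hq.two_le; omega
    have hsv : k * t ≤ (q - 1).factorization 2 :=
      (Nat.prime_two.pow_dvd_iff_le_factorization hqm1).mp hsq
    have htk : t ≤ (q - 1).factorization 2 / k := by
      rw [Nat.le_div_iff_mul_le hk, mul_comm]; exact hsv
    exact (Nat.pow_le_pow_right (by norm_num) htk).trans h

/-! ## The compositions: the line closed modulo `FreyModularity` and `ForcedPairXiDvd` -/

/-- **`FreyModularity → ForcedPairXiDvd → ProthDepthFamily`** — the skeleton target of line `forced-pair-dlog` BY NAME
from the route item stmt-ABC-11340 and the setup-free research statement alone (multiplicity one is PROVED: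
`brandtEigenLatticeRankOne_holds`; the prime supply is the theorem `exists_primes_two_pow_mul_dvd_sub_one`, p132885).
For the lead's rev 6: `ProthDepthFamily_of := prothDepthFamily_of_freyModularity_of_forcedPairXiDvd stub_freyModularity
stub_forcedPairXiDvd`. [cite: Takahashi2001, §2 p. 78] -/
theorem prothDepthFamily_of_freyModularity_of_forcedPairXiDvd
    (hM : Summit.ABC.ABC.Theses.DefiniteXi.FreyModularity) (h : ForcedPairXiDvd) : ProthDepthFamily :=
  prothDepthFamily_of_items_of_forcedPairOccurrence
    Summit.ABC.ABC.Theorems.brandtEigenLatticeRankOne_holds hM (forcedPairOccurrence_of_xiDvd h)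

/-- **`EisensteinQuarantine` (stmt-ABC-15023) is false under `FreyModularity` (route item stmt-ABC-11340, TRUE in print)
and the setup-free forced-pair divisibility law `ForcedPairXiDvd` (research)** — via `ProthDepthFamily` and the landed
kill p107816.  The displayed arithmetic input is one natural-number divisibility per forced pair. [cite: Mazur1977, II.16.6 and II.18.10] -/
theorem EisensteinQuarantine_false_of_ForcedPairXiDvd
    (hM : Summit.ABC.ABC.Theses.DefiniteXi.FreyModularity) (h : ForcedPairXiDvd) :
    ¬ Summit.ABC.ABC.Theses.DefiniteXi.EisensteinQuarantine :=
  EisensteinQuarantine_false_of_ProthDepthFamily (prothDepthFamily_of_freyModularity_of_forcedPairXiDvd hM h)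

end Summit.ABC.ABC.Theorems.EisensteinQuarantine.Negative

end
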